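import Literature.NumberTheory.ComplexMultiplication.FaltingsTateOfCMType
import Summits.HodgeConjecture.HodgeConjecture.Theorems.HCCMUnconditionalShimuraThm18_6Holds
import HarnessLib

/-!
# T5 (N9) — [Fal83 §5 Kor. 1] for EVERY pair of abelian varieties over a number field of CM type over `ℂ`, UNCONDITIONALLY

Cell hodgecm-mathlib, fan A, binder hLiu418 (item stmt-HodgeConjecture-24832), sub-skeleton
`Cruxes/HLiu418/Lines/faltings_isogeny.lean` (row VI-1 = the floor binder
`hFal : ∀ {K} [Field K] (A B : AbelianVariety K) ℓ [Fact ℓ.Prime], faltings_tate_bijective A B ℓ`; T5 ledger CAPSTONE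
(N9), A-plan1 g8 road of record 01:13:03Z).  The Literature head of
`Literature.NumberTheory.ComplexMultiplication.FaltingsTateOfCMType` proves, granted the named fact `shimura1998_thm18_6`
([Shimura 1998, Thm. 18.6]), that for abelian varieties `A, A'` over a number field `k ⊆ ℂ` whose complexifications are
of CM type (★ `Milne1999.IsOfCMType` — the hypothesis of the summit's `CMAbelianHodge`, read over number fields; no
`k`-rationality of the complex multiplication) the Tate map `ℤ_ℓ ⊗ Hom_k(A, A') → Hom_{Γ_k}(T_ℓ A, T_ℓ A')` is bijective for
every prime `ℓ`; that fact is a THEOREM of the tree Summits-side (`Theorems.shimura1998_thm18_6_holds`, row II-1), so here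
the VI-1 TEXT ITSELF is decided with NO hypothesis on the whole CM class — the Tate conjecture / Faltings' isogeny
theorem for CM abelian varieties over number fields, without heights.  Witness rung («distance ledger»): the floor binder
stays general-`P`; no floor change, books 0.

HC_CM is proved only modulo the printed citations of the floor until rung 0 closes; this file moves no floor binder.
-/

-- mandated namespace `Summit.HodgeConjecture.HodgeConjecture.Theorems` trips `linter.dupNamespace` (single-problem
-- summit); off as in `HCCMUnconditionalShimuraThm18_6Holds.lean`.
set_option linter.dupNamespace false

open CategoryTheory CategoryTheory.Limits NumberField
open scoped NumberField

namespace Summit.HodgeConjecture.HodgeConjecture.Theorems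

open Literature.AlgebraicGeometry.Motives
open Literature.AlgebraicGeometry.Milne1999 (IsOfCMType)
open Literature.NumberTheory.ComplexMultiplication

/-- **[Faltings 1983, §5 Kor. 1] for every pair of abelian varieties over a number field that are of CM type over `ℂ`,
unconditionally**: the Tate map `ℤ_ℓ ⊗ Hom_k(A, A') → Hom_{Γ_k}(T_ℓ A, T_ℓ A')` is bijective — the Literature head fed with
the tree's theorem `shimura1998_thm18_6_holds`. [cite: Faltings1983Endlichkeit, §5 Korollar 1]
[cite: Shimura1998, §13.2 Theorem 2 and §18.6 Theorem 18.6] [cite: Milne1999, §2 p. 54] -/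
theorem faltings_tate_bijective_of_isOfCMType
    {k : Type} [Field k] [NumberField k] [Algebra k ℂ] (A A' : AbelianVariety k)
    (hA : IsOfCMType (A.baseChange ℂ)) (hA' : IsOfCMType (A'.baseChange ℂ)) (ℓ : ℕ) [Fact ℓ.Prime] :
    faltings_tate_bijective A A' ℓ := by
  have hk := faltings_tate_bijective_of_isOfCMType_of_thm18_6 shimura1998_thm18_6_holds A A' hA hA' ℓ
  intro _
  exact hk

/-- **[Faltings 1983, §5 Satz 4] (`End` form) for every abelian variety over a number field of CM type over `ℂ`,
unconditionally.** [cite: Faltings1983Endlichkeit, §5 Satz 4] [cite: Shimura1998, §18.6 Theorem 18.6] -/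
theorem faltings_tate_bijective_self_of_isOfCMType
    {k : Type} [Field k] [NumberField k] [Algebra k ℂ] (A : AbelianVariety k) (hA : IsOfCMType (A.baseChange ℂ))
    (ℓ : ℕ) [Fact ℓ.Prime] : faltings_tate_bijective A A ℓ := by
  have hk := faltings_tate_bijective_self_of_isOfCMType_of_thm18_6 shimura1998_thm18_6_holds A hA ℓ
  intro _
  exact hk

/-- **… and on the `k`-isogeny classes**, unconditionally. [cite: Faltings1983Endlichkeit, §5 Korollar 1 and §5 ¶1] -/
theorem faltings_tate_bijective_of_isIsogenous_of_isOfCMType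
    {k : Type} [Field k] [NumberField k] [Algebra k ℂ] {A A' B B' : AbelianVariety k}
    (hA : IsOfCMType (A.baseChange ℂ)) (hA' : IsOfCMType (A'.baseChange ℂ))
    (hB : AbelianVariety.IsIsogenous A B) (hB' : AbelianVariety.IsIsogenous A' B') (ℓ : ℕ) [Fact ℓ.Prime] :
    faltings_tate_bijective B B' ℓ := by
  have hk := faltings_tate_bijective_of_isIsogenous_of_isOfCMType_of_thm18_6 shimura1998_thm18_6_holds hA hA' hB hB' ℓ
  intro _
  exact hk

end Summit.HodgeConjecture.HodgeConjecture.Theorems
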